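import Summits.QuantumFields.YangMills.Theorems.BalabanUVNodesN16H7OfN07RecordSlotKey
import Summits.QuantumFields.YangMills.Theorems.BalabanUVNodesN16Thm1AtTorusVPSmallCubesRankN
import HarnessLib

/-!
# Route «BalabanUVNodes» (K3⁷ `SpineGivenEndpointR13SepCoPH`, stmt-QuantumFields-20544), DAG node N16 = NE3, in-edge N07 → N16 — THE QUARTER THRESHOLD OF THE
# SLOT KEY's (8)-RADIUS CONSTANT `B₃`: below `B₃ = 1∕4` the existence half (T8) is FALSE (rank two; `1∕32` in every rank), the regularity half (T9ˢ) is the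
# FULL-WINDOW `stub_h7` leaf (tight window included), and the `∃ C` of `stub_reg910Slot` ranges WITHOUT LOSS over `B₃ ≥ 1∕4`

Cell `pub-ymgap`, width seat `pub-ymgap-dag-n16-w1` (director-ym №197 ∕ HUMAN RULING D-0149), generation 6, file 13 of this lineage (generation 5 = files 9∕9b∕10∕11∕12:
`…N16H7LooseOfReg910Slot[Family]` p609800∕p613191, `…N16H7OfN07RecordSlotKey` p613213, `…N16SlotKeyWitnesses` p612064, `…N16SlotKeyNormalForm` p615276).
`--kind proof --supports stmt-QuantumFields-20544 --as helper` (count-neutral).  `bears_on: R4∕N16 · edge N07 → N16`.  THEOREMS ONLY (0 `def`, 0 `sorry`, standard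
axioms); BY NAME over this lineage's files 4 (`…N16H7NoBinding.datum_mem_sfClass_of_isMinimiser` = [Balaban1985Averaging] Prop. 2 (54) for a minimiser's datum), 9
(`leafH3sup_loose_of_reg910Slot`), 10 (`Thm1AtTransfer04toSlot`), dag-n16-w2's `…SmallCubesPrep.exists_constDatum` (constant `SU(2)` datum, one plaquette at distance EXACTLY
`ε`) and dag-n16-w5's `…SmallCubesRankN.exists_twisted_datum` (a non-flat small datum in every rank).

THE POINT (the remark left un-typed in file 9's header ∕ `LOCATED-N16-SLOT-KEY.md` §4, with its consequences for BOTH halves of the key).  After files 9–12 node N07's in-edge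
on the (β16) loose road is the SLOT KEY at constants `C : B11Thm1.Consts`: (T9ˢ) «(9)–(10) in some gauge on the collar-slot cube about every site, at every minimiser of the
Wilson action over the (8)-class `sfClass d L N (B₃ε₁) (k+1)` with a datum `V ∈ sfClass d L N ε₁ 0`, `0 < ε₁ ≤ a₁`» and (T8) «such a minimiser exists at every such datum»;
dag-n16-e's ∕ dag-n16-w2's DischargeTest v6 ∕ v6L key `stub_reg910Slot F := ∃ G C, RadiiMono 4 G ∧ interface G ∧ (T9ˢ)(G, C)` on it, with `B₃` FREE.  `B₃ = 1∕4` is a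
threshold, in the kernel:
* §1 **(T8) ⟹ `1∕4 ≤ B₃`.**  An (8)-class minimiser's datum is `4B₃ε₁`-small (file 4 §1), so a datum of `sfClass d L N ε₁ 0` with a plaquette at distance `≥ q·ε₁` from `1`
  forces `q ≤ 4B₃` (`le_four_mul_B₃_of_exists8Min_of_witness`); the constant `SU(2)` datum (`q = 1`; rank two, `d ≥ 2`, `L ≥ 2`, any `N`) gives
  `quarter_le_B₃_of_exists8Min_rank_two` ∕ `not_exists8Min_rank_two_of_B₃_lt_quarter`, the twisted datum (`q = 1∕8`; every rank, `N ≥ 2`) `inv32_le_B₃_of_exists8Min`.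
  §1b: on THIS LINEAGE's displayed hypothesis `Thm1AtTransfer04toSlot F N ζ B` (file 10; consequent `∃ C′, C′.B₃ ≤ B ∧ (T9ˢ) ∧ (T8)`): at `B < 1∕4`, rank two, the
  consequent is UNINHABITABLE, so the transfer ⟺ `¬`(node N07's K1-side Theorem-1 sentence) and «`B11Leaf (Z11OfRecord F 2 ζ)` ∧ transfer» is uninhabited — the chair's
  A6 species, flagged on my own def; every consumer of record keys `B` far above (modules 46∕47 `B F := max (C F).B₃ (ε∕b)`; `B ≥ 2^78·L^12`, dag-n21-w6 p614571).
* §2 **(T9ˢ) at `B₃ ≤ 1∕4` ⟹ THE `stub_h7` LEAF ON ALL DATA.**  File 9 §2 derives from the slot key the leaf `LeafH3sup d L N ε ε (16937ε)` on the LOOSE data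
  `{V ∈ dom | V ∈ sfClass d L N (ε∕B₃) 0}`; below the threshold that restriction is AUTOMATIC for every datum carrying an `ε`-minimiser (`4ε ≤ ε∕B₃`, file 4 §1), so the
  leaf holds on EVERY `dom` (`leafH3sup_all_of_reg910Slot_of_B₃_le_quarter`, `h7Shape_…`), and at the record's letters with dag-n16-e's original `stub_h7 F` VERBATIM as
  conclusion (`h7_at_record_of_reg910Slot_of_B₃_le_quarter`) — tight window AP-N16-2 included, the leaf file 5 `…N16H7Fronts` + evidence #27∕#28 (FRONTS) locate as MODEL-FALSE.
  So a producer of the slot key with `B₃ ≤ 1∕4` would be closing the tight window; print's producer has `B₃ ≥ 72d³L³B₀` ([Balaban1985Variational] (162)).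
* §3 **WINDOW NORMALISATION.**  For leaf-06's `torusVP`, r2's `B11.Regularity … B₃ B₄ ε₁ U c` reads `(B₃, ε₁)` only through the product `B₃ε₁` and `B₄` only through
  `0 < B₄` (`regularity_torusVP_rescale`: `holderA = 0`, all three norms `= Ψ`).  Hence (T9ˢ)(G, C) and (T8)(C) are ANTITONE IN THE WINDOW RATIO `1∕B₃` at fixed top
  radius `B₃a₁` (`reg910Slot_mono_B₃`, `exists8Min_mono_B₃`: key at `C` ⟹ key at every `C′` with `C.B₃ ≤ C′.B₃`, `C′.B₃·C′.a₁ ≤ C.B₃·C.a₁` — rescale `ε₁ ↦ C′.B₃ε₁∕C.B₃`, the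
  datum window only shrinks), and **`(∃ C, key) ⟺ (∃ C, 1∕4 ≤ C.B₃ ∧ key)`** (`exists_consts_iff_quarter_le`; the `∃ G C` shape of the DischargeTests' stub:
  `exists_shape_consts_iff_quarter_le`): the `∃ C` of `stub_reg910Slot` ranges WITHOUT LOSS over `B₃ ≥ 1∕4` — for the producer AND for a disprover (attacking small `B₃` is
  attacking the model-false tight window again); the key's only free real parameters are the top radius `B₃a₁` and the window ratio `1∕B₃ ≤ 4`.

HONEST FRAMING.  Kernel bookkeeping over landed theorems BY NAME (Prop. 2 in the tree's explicit form; two datum witnesses of dag-n16-w2 ∕ dag-n16-w5) plus one rescaling;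
the slot key stays a DISPLAYED hypothesis (node N07's content = [Balaban1985Variational] Thm 1 (8)–(10) at the (42)-objects + the (0.4)→(42) transfer + the located items
A1 ∕ D-s3-2), NOT asserted and NOT refuted at or above the threshold; `stub_h7` NOT closed; no stub of K3⁷ v5 named or closed; N16 ∕ N07 ∕ N19 NOT discharged;
count-neutral; counts of record unmoved (typed 28∕28 · discharged 5∕28); one finite four-torus at fixed `ε`, Bałaban AS PRINTED — NOT ℝ⁴, NOT infinite volume, NOT OS,
NOT a mass gap; the YM mass gap (Clay) is NOT proved by any of this — R4 closes the conditional finite-𝕋⁴ rung `BalabanLadder.UV` only.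
-/

set_option autoImplicit false

open scoped BigOperators Matrix Matrix.Norms.L2Operator
open NormedSpace

namespace Summit.QuantumFields.YangMills.BalabanUVNodes.N16SlotKeyQuarter

open Literature.MathematicalPhysics.QuantumFieldTheory.Balaban1983to89
open B7Prop1Explicit B7Prop2Explicit MatrixLog UnitaryModel
open T4AveragingDeficitWall hiding Site Plane Plaq Bond
open T4Continuum (T4Family)
open Summit.QuantumFields.BalabanUV.T4Continuum
open AveragingDeficitLatticeH2Prep (fd)
open MinimalActionSandwich (IsMinimiser)
open MinimalActionRate (sfClass)
open MinimalActionDictionary (torusVP RadiiMono cubeM cubeM_pos gaugeFactors gaugeInf sfClass_mono)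
open NE3.LeafIndexSockets (LeafH3sup)
open B11 (Regularity)
open B11Thm1 (Thm1At)
open B11Thm1CarrierT (varProblemT)
open DagBinding (B11Leaf)
open Node00 (ne3NperOfRecord₁₁ ne3DomOfRecord₁₁ MatA ZIdx ResidZ Z11OfRecord exists_thm1At_of_b11Leaf_Z11OfRecord)
open Summit.QuantumFields.YangMills.BalabanUVNodes.N16H7OfReg9 (leafH3sup_mono)
open Summit.QuantumFields.YangMills.BalabanUVNodes.N16H7NoBinding (datum_mem_sfClass_of_isMinimiser)
open Summit.QuantumFields.YangMills.BalabanUVNodes.N16H7OfN07RecordSlot (lipGauge radiiMono_lipGauge' interface_lipGauge')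
open Summit.QuantumFields.YangMills.BalabanUVNodes.N16H7LooseOfReg910Slot (leafH3sup_loose_of_reg910Slot)
open Summit.QuantumFields.YangMills.BalabanUVNodes.N16H7OfN07RecordSlotKey (Thm1AtTransfer04toSlot)
open Summit.QuantumFields.YangMills.BalabanUVNodes.N16Thm1AtTorusVPSmallCubesPrep (exists_constDatum)
open Summit.QuantumFields.YangMills.BalabanUVNodes.N16Thm1AtTorusVPSmallCubesRankN (exists_twisted_datum half_le_norm_exp_I_mul_sub_one)

noncomputable section

section Generic

variable {d : ℕ} {n : Type} [Fintype n] [DecidableEq n]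

/-! ## §1 (T8) forces `1∕4 ≤ B₃`: the existence half of the slot key is false below the threshold -/

/-- **(T8) AND A DATUM WITNESS FORCE `q ≤ 4B₃`.**  Let `L ≥ 2`.  If (T8) holds at constants `C` — a minimiser of the Wilson action over the (8)-class
`sfClass d L N (B₃ε₁) (k+1)` exists at every datum `V ∈ sfClass d L N ε₁ 0`, `0 < ε₁ ≤ a₁`, every run `k+1` — and for all small `ε₁` the class `sfClass d L N ε₁ 0`
contains a datum with one plaquette at distance `≥ q·ε₁` from `1`, then `q ≤ 4·B₃`: at run `1` the minimiser's datum is `4B₃ε₁`-small ([Balaban1985Averaging] Prop. 2 (54)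
BY NAME through file 4 §1 `datum_mem_sfClass_of_isMinimiser`, in its regime `C₀(d)·2B₃ε₁ ≤ ⅓`, `4B₃ε₁ ≤ c₂′(d,L)`, met by taking `ε₁` small). [cite: Balaban1985Averaging, Prop. 2 (52)–(54) p.26] -/
theorem le_four_mul_B₃_of_exists8Min_of_witness [Nonempty n] {L N : ℕ} (hL : 2 ≤ L) (C : B11Thm1.Consts)
    (hE : ∀ (k : ℕ) (ε₁ : ℝ), 0 < ε₁ → ε₁ ≤ C.a₁ → ∀ V : Site d → Fin d → (Matrix n n ℂ)ˣ, V ∈ sfClass d L N ε₁ 0 →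
      ∃ U : Site d → Fin d → (Matrix n n ℂ)ˣ, IsMinimiser d (sfClass d L N (C.B₃ * ε₁)) L N (k + 1) V U)
    {q w₀ : ℝ} (hw₀ : 0 < w₀)
    (hW : ∀ ε₁ : ℝ, 0 < ε₁ → ε₁ ≤ w₀ → ∃ V : Site d → Fin d → (Matrix n n ℂ)ˣ, V ∈ sfClass d L N ε₁ 0 ∧
      ∃ (x : Site d) (κ κ' : Fin d), κ ≠ κ' ∧ q * ε₁ ≤ ‖((hol V x (plaqWord κ κ') : (Matrix n n ℂ)ˣ) : Matrix n n ℂ) - 1‖) :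
    q ≤ 4 * C.B₃ := by
  have hB₃ := C.B₃_pos
  have hC0 := C0_pos d
  have hc2 := c2'_pos d L (by omega)
  -- one radius in every regime at once
  set ε₁ : ℝ := min (min C.a₁ w₀) (min (1 / (6 * C0 d * C.B₃)) (c2' d L / (4 * C.B₃))) with hε₁def
  have hε₁ : 0 < ε₁ := lt_min (lt_min C.a₁_pos hw₀) (lt_min (by positivity) (by positivity))
  have h3 : ε₁ ≤ 1 / (6 * C0 d * C.B₃) := (min_le_right _ _).trans (min_le_left _ _)
  have h4 : ε₁ ≤ c2' d L / (4 * C.B₃) := (min_le_right _ _).trans (min_le_right _ _)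
  obtain ⟨V, hV, x, κ, κ', hκ, hq⟩ := hW ε₁ hε₁ ((min_le_left _ _).trans (min_le_right _ _))
  obtain ⟨U, hU⟩ := hE 0 ε₁ hε₁ ((min_le_left _ _).trans (min_le_left _ _)) V hV
  have hr : 0 < C.B₃ * ε₁ := mul_pos hB₃ hε₁
  have hr3 : C0 d * (2 * (C.B₃ * ε₁)) ≤ 1 / 3 := by
    have h : ε₁ * (6 * C0 d * C.B₃) ≤ 1 := by rwa [le_div_iff₀ (by positivity)] at h3
    nlinarith
  have hr2 : 2 * (2 * (C.B₃ * ε₁)) ≤ c2' d L := by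
    have h : ε₁ * (4 * C.B₃) ≤ c2' d L := by rwa [le_div_iff₀ (by positivity)] at h4
    nlinarith
  obtain ⟨-, -, hs⟩ := datum_mem_sfClass_of_isMinimiser hL hr hr3 hr2 hU
  have hplaq := hs x κ κ' hκ
  simp only [pow_zero, one_pow, div_one] at hplaq
  exact le_of_mul_le_mul_right (by linarith : q * ε₁ ≤ 4 * C.B₃ * ε₁) hε₁

/-- **★ (T8) ⟹ `1∕4 ≤ B₃` AT RANK TWO** (`Matrix (Fin 2) (Fin 2) ℂ`; any `d ≥ 2`, `L ≥ 2`, torus factor `N`): dag-n16-w2's constant `SU(2)` datum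
(`N16Thm1AtTorusVPSmallCubesPrep.exists_constDatum`) lies in `sfClass d L N ε₁ 0` for every `0 ≤ ε₁ ≤ 2` with its `(0,1)`-plaquette at distance EXACTLY `ε₁` from `1`, so
the witness lemma applies with `q = 1`; print's `B₃ ≥ 72d³L³B₀` ([Balaban1985Variational] (162)) is far above. [cite: Balaban1985Variational, Thm 1 (8) p.279] -/
theorem quarter_le_B₃_of_exists8Min_rank_two (hd : 2 ≤ d) {L N : ℕ} (hL : 2 ≤ L) (C : B11Thm1.Consts)
    (hE : ∀ (k : ℕ) (ε₁ : ℝ), 0 < ε₁ → ε₁ ≤ C.a₁ → ∀ V : Site d → Fin d → (Matrix (Fin 2) (Fin 2) ℂ)ˣ, V ∈ sfClass d L N ε₁ 0 →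
      ∃ U : Site d → Fin d → (Matrix (Fin 2) (Fin 2) ℂ)ˣ, IsMinimiser d (sfClass d L N (C.B₃ * ε₁)) L N (k + 1) V U) :
    1 / 4 ≤ C.B₃ := by
  have h01 : (⟨0, by omega⟩ : Fin d) ≠ ⟨1, by omega⟩ := by simp [Fin.ext_iff]
  have h := le_four_mul_B₃_of_exists8Min_of_witness hL C hE (q := 1) (w₀ := 2) (by norm_num) (fun ε₁ hε₁ hε₁2 => ?_)
  · linarith
  obtain ⟨V, -, hV, hplaq⟩ := exists_constDatum L N h01 hε₁.le hε₁2
  exact ⟨V, hV, 0, _, _, h01, by rw [one_mul, hplaq]⟩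

/-- **(T8) IS FALSE BELOW THE THRESHOLD AT RANK TWO** (`C.B₃ < 1∕4`; `d ≥ 2`, `L ≥ 2`, any `N`).  Nothing of print is refuted (print's `B₃` is large); it is the free
binder `C` of the DischargeTests' stubs that must respect the bound wherever (T8) is read (N19's `sel` rows, file 10's transfer). [cite: Balaban1985Variational, Thm 1 (8) p.279] -/
theorem not_exists8Min_rank_two_of_B₃_lt_quarter (hd : 2 ≤ d) {L N : ℕ} (hL : 2 ≤ L) (C : B11Thm1.Consts) (hB : C.B₃ < 1 / 4) :
    ¬ ∀ (k : ℕ) (ε₁ : ℝ), 0 < ε₁ → ε₁ ≤ C.a₁ → ∀ V : Site d → Fin d → (Matrix (Fin 2) (Fin 2) ℂ)ˣ, V ∈ sfClass d L N ε₁ 0 →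
      ∃ U : Site d → Fin d → (Matrix (Fin 2) (Fin 2) ℂ)ˣ, IsMinimiser d (sfClass d L N (C.B₃ * ε₁)) L N (k + 1) V U := fun hE =>
  absurd (quarter_le_B₃_of_exists8Min_rank_two hd hL C hE) (not_le.2 hB)

/-- **(T8) ⟹ `1∕32 ≤ B₃` IN EVERY RANK** (`U(N)`-valued, `Matrix n n ℂ`, `n` non-empty; `d ≥ 2`, `L ≥ 2`, torus factor `N ≥ 2`): dag-n16-w5's twisted datum
(`N16Thm1AtTorusVPSmallCubesRankN.exists_twisted_datum` at `θ = ε₁∕4`) lies in `sfClass d L N ε₁ 0` with one plaquette at distance `|e^{iθ} − 1| ≥ θ∕2 = ε₁∕8` from `1`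
(`half_le_norm_exp_I_mul_sub_one`): the witness lemma with `q = 1∕8` (the slack `4|θ|` of that lemma's class radius costs the factor `8`). [cite: Balaban1985Variational, Thm 1 (8) p.279] -/
theorem inv32_le_B₃_of_exists8Min [Nonempty n] (hd : 2 ≤ d) {L N : ℕ} (hL : 2 ≤ L) (hN : 2 ≤ N) (C : B11Thm1.Consts)
    (hE : ∀ (k : ℕ) (ε₁ : ℝ), 0 < ε₁ → ε₁ ≤ C.a₁ → ∀ V : Site d → Fin d → (Matrix n n ℂ)ˣ, V ∈ sfClass d L N ε₁ 0 →
      ∃ U : Site d → Fin d → (Matrix n n ℂ)ˣ, IsMinimiser d (sfClass d L N (C.B₃ * ε₁)) L N (k + 1) V U) :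
    1 / 32 ≤ C.B₃ := by
  have h := le_four_mul_B₃_of_exists8Min_of_witness hL C hE (q := 1 / 8) (w₀ := 4) (by norm_num) (fun ε₁ hε₁ hε₁4 => ?_)
  · linarith
  obtain ⟨V, hV, x, κ, κ', hκ, hplaq⟩ := exists_twisted_datum (n := n) hd hN L (ε₁ / 4)
  have hθ : 4 * |ε₁ / 4| = ε₁ := by rw [abs_of_nonneg (by positivity)]; ring
  rw [hθ] at hV
  refine ⟨V, hV, x, κ, κ', hκ, ?_⟩
  rw [hplaq]
  have h2 := half_le_norm_exp_I_mul_sub_one (θ := ε₁ / 4) (by positivity) (by linarith)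
  linarith

end Generic

/-! ### §1b Consequence for this lineage's displayed transfer `Thm1AtTransfer04toSlot` (file 10) at a radius letter below the threshold -/

section TransferTwo

/-- **THE CONSEQUENT OF `Thm1AtTransfer04toSlot F 2 ζ B` IS UNINHABITABLE FOR `B < 1∕4`**: it asks for constants `C′` with `C′.B₃ ≤ B` AND (T8) at `C′` (rank two, `d = 4`,
`L = F.L ≥ 2`), which §1 excludes.  [cite: Balaban1985Variational, Thm 1 (8) p.279] -/
theorem not_consequent_transferSlot_two_of_lt_quarter (F : T4Family) {B : ℝ} (hB : B < 1 / 4) :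
    ¬ ∃ C' : B11Thm1.Consts, C'.B₃ ≤ B ∧
      (∀ (k : ℕ) (ε₁ : ℝ), 0 < ε₁ → ε₁ ≤ C'.a₁ → ∀ (V U : Site 4 → Fin 4 → (MatA 2)ˣ), V ∈ sfClass 4 F.L (ne3NperOfRecord₁₁ F 0 0) ε₁ 0 →
        IsMinimiser 4 (sfClass 4 F.L (ne3NperOfRecord₁₁ F 0 0) (C'.B₃ * ε₁)) F.L (ne3NperOfRecord₁₁ F 0 0) (k + 1) V U →
          ∀ x : Site 4, Regularity (torusVP 4 F.L (ne3NperOfRecord₁₁ F 0 0) (lipGauge 4 (Fin 2)) (k + 1)) C'.B₃ C'.B₄ ε₁ U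
            (x, F.L ^ (k + 1) - 1 + F.L ^ (k + 1) + 2)) ∧
      (∀ (k : ℕ) (ε₁ : ℝ), 0 < ε₁ → ε₁ ≤ C'.a₁ → ∀ V : Site 4 → Fin 4 → (MatA 2)ˣ, V ∈ sfClass 4 F.L (ne3NperOfRecord₁₁ F 0 0) ε₁ 0 →
        ∃ U : Site 4 → Fin 4 → (MatA 2)ˣ, IsMinimiser 4 (sfClass 4 F.L (ne3NperOfRecord₁₁ F 0 0) (C'.B₃ * ε₁)) F.L (ne3NperOfRecord₁₁ F 0 0) (k + 1) V U) := by
  rintro ⟨C', hB₃, -, hE⟩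
  have h := quarter_le_B₃_of_exists8Min_rank_two (d := 4) (by norm_num) F.hL.2 C' hE
  linarith

/-- **★ BELOW THE THRESHOLD THE SLOT-KEYED TRANSFER IS `¬`(NODE N07's K1-SIDE THEOREM-1 SENTENCE)** (rank two): for `B < 1∕4`, `Thm1AtTransfer04toSlot F 2 ζ B` — an
implication with an uninhabitable consequent — holds IFF its antecedent (Theorem 1 at NODE 00's (0.4)-objects — node N07's content, about which nothing is claimed) fails.
The chair's A6 species, flagged on MY OWN def of file 10; every consumer of record keys `B` far above `1∕4` (modules 46∕47: `B F := max (C F).B₃ (ε∕b)`; N19′'s rows force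
`B ≥ 2^78·L^12`, dag-n21-w6), so no landed theorem is affected. [folklore] -/
theorem transferSlot_two_iff_not_of_lt_quarter (F : T4Family) (ζ : ResidZ F 2) {B : ℝ} (hB : B < 1 / 4) :
    Thm1AtTransfer04toSlot F 2 ζ B ↔ ¬ ∃ C : B11Thm1.Consts, ∀ i : ZIdx, Thm1At C (varProblemT F 2 i.K i.k (ζ.R i)) :=
  ⟨fun hT hA => not_consequent_transferSlot_two_of_lt_quarter F hB (hT hA), fun hn hA => absurd hA hn⟩

/-- Hence for `B < 1∕4` the hypothesis pair «`B11Leaf (Z11OfRecord F 2 ζ)` ∧ `Thm1AtTransfer04toSlot F 2 ζ B`» of file 10 §2 is UNINHABITED: the K1 leaf of record supplies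
the antecedent (`Node00.exists_thm1At_of_b11Leaf_Z11OfRecord`). [folklore] -/
theorem not_b11Leaf_and_transferSlot_two_of_lt_quarter (F : T4Family) (ζ : ResidZ F 2) {B : ℝ} (hB : B < 1 / 4) :
    ¬ (B11Leaf (Z11OfRecord F 2 ζ) ∧ Thm1AtTransfer04toSlot F 2 ζ B) := by
  rintro ⟨h07, hT⟩
  exact (transferSlot_two_iff_not_of_lt_quarter F ζ hB).1 hT (exists_thm1At_of_b11Leaf_Z11OfRecord h07)

end TransferTwo

section GenericTwo

variable {d : ℕ} {n : Type} [Fintype n] [DecidableEq n]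

/-! ## §2 (T9ˢ) at `B₃ ≤ 1∕4` gives the `stub_h7` leaf on ALL data (tight window included) -/

/-- **★★ BELOW THE THRESHOLD THE SLOT KEY DELIVERS THE LEAF (H3ˢᵘᵖ) ON EVERY `dom` — NO LOOSE RESTRICTION.**  Let `L ≥ 2`; `G` radii-monotone (`hGm`) with the (9)_{β₀=1}
interface `hG`; constants `C` with `C.B₃ ≤ 1∕4`; the SLOT KEY (T9ˢ) `hR` (DISPLAYED, asserted for nothing); and `0 < ε ≤ min(B₃a₁, 1∕28)` in Prop. 2's regime
`C₀(d)·2ε ≤ ⅓`, `4ε ≤ c₂′(d,L)`.  THEN `LeafH3sup d L N ε ε (16937ε) dom` for EVERY `dom`: a datum carrying an `ε`-minimiser lies in `sfClass d L N (4ε) 0 ⊆ sfClass d L N (ε∕B₃) 0`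
(file 4 §1 `datum_mem_sfClass_of_isMinimiser`; `4ε ≤ ε∕B₃` iff `B₃ ≤ 1∕4`), so file 9 §2's loose leaf `leafH3sup_loose_of_reg910Slot` covers it.  This is the TIGHT WINDOW
AP-N16-2 INCLUDED — the leaf this lineage's file 5 + evidence #27∕#28 (FRONTS) locate as model-false. [cite: Balaban1985Variational, Thm 1 (9)–(10) p.279] -/
theorem leafH3sup_all_of_reg910Slot_of_B₃_le_quarter [Nonempty n] {L N : ℕ} (hL : 2 ≤ L)
    {G : (Site d → Fin d → (Matrix n n ℂ)ˣ) → Site d → ℕ → ℝ → ℝ → ℝ → Prop} (hGm : RadiiMono d G)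
    (hG : ∀ (U : Site d → Fin d → (Matrix n n ℂ)ˣ) (x : Site d) (K : ℕ) (α₀ α₁ α₂ : ℝ), 2 ≤ K → G U x K α₀ α₁ α₂ →
      ∃ (u : Site d → (Matrix n n ℂ)ˣ) (a : Site d → Fin d → Matrix n n ℂ),
        (∀ z, u z ∈ unitaryUnits (Matrix n n ℂ)) ∧
        (∀ (y : Site d) (τ : Fin d), l1 (y - x) ≤ 2 → ((gaugeAct u U y τ : (Matrix n n ℂ)ˣ) : Matrix n n ℂ) = exp (a y τ)) ∧
        (∀ (y : Site d) (τ : Fin d), l1 (y - x) ≤ 2 → ‖a y τ‖ ≤ α₀) ∧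
        (∀ (y : Site d) (τ i : Fin d), l1 (y - x) ≤ 1 → ‖fd i (fun z => a z τ) y‖ ≤ α₁) ∧
        (∀ (τ i l : Fin d), ‖fd i (fd l (fun z => a z τ)) x‖ ≤ α₂))
    (C : B11Thm1.Consts) (hB : C.B₃ ≤ 1 / 4)
    (hR : ∀ (k : ℕ) (ε₁ : ℝ), 0 < ε₁ → ε₁ ≤ C.a₁ → ∀ (V U : Site d → Fin d → (Matrix n n ℂ)ˣ), V ∈ sfClass d L N ε₁ 0 →
      IsMinimiser d (sfClass d L N (C.B₃ * ε₁)) L N (k + 1) V U →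
        ∀ x : Site d, Regularity (torusVP d L N G (k + 1)) C.B₃ C.B₄ ε₁ U (x, L ^ (k + 1) - 1 + L ^ (k + 1) + 2))
    {ε : ℝ} (hε : 0 < ε) (hεa : ε ≤ C.B₃ * C.a₁) (hε28 : ε ≤ 1 / 28) (hε3 : C0 d * (2 * ε) ≤ 1 / 3) (hε2 : 2 * (2 * ε) ≤ c2' d L)
    (dom : Set (Site d → Fin d → (Matrix n n ℂ)ˣ)) :
    LeafH3sup d L N ε ε (16937 * ε) dom := by
  have hL1 : 1 ≤ L := by omega
  have hloose := leafH3sup_loose_of_reg910Slot hL1 hGm hG C hR hε hεa hε28 dom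
  intro V hV k U hU
  have hV4 : V ∈ sfClass d L N (4 * ε) 0 := datum_mem_sfClass_of_isMinimiser hL hε hε3 hε2 hU
  have h4 : 4 * ε ≤ ε / C.B₃ := by rw [le_div_iff₀ C.B₃_pos]; nlinarith [hε.le]
  exact hloose V ⟨hV, sfClass_mono h4 hV4⟩ k U hU

/-- **THE `∃ C′ ε₀` SHAPE ON ALL DATA BELOW THE THRESHOLD** (`C′ = 16937`, `ε₀ = min(B₃a₁, 1∕28, 1∕(6C₀(d)), c₂′(d,L)∕4)`): for `C.B₃ ≤ 1∕4` the slot key gives the linear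
leaf on every `dom` — dag-n16-e's `stub_h7` SHAPE with no loose cut. [cite: Balaban1985Variational, Thm 1 (9)–(10) p.279] -/
theorem h7Shape_of_reg910Slot_of_B₃_le_quarter [Nonempty n] {L N : ℕ} (hL : 2 ≤ L)
    {G : (Site d → Fin d → (Matrix n n ℂ)ˣ) → Site d → ℕ → ℝ → ℝ → ℝ → Prop} (hGm : RadiiMono d G)
    (hG : ∀ (U : Site d → Fin d → (Matrix n n ℂ)ˣ) (x : Site d) (K : ℕ) (α₀ α₁ α₂ : ℝ), 2 ≤ K → G U x K α₀ α₁ α₂ →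
      ∃ (u : Site d → (Matrix n n ℂ)ˣ) (a : Site d → Fin d → Matrix n n ℂ),
        (∀ z, u z ∈ unitaryUnits (Matrix n n ℂ)) ∧
        (∀ (y : Site d) (τ : Fin d), l1 (y - x) ≤ 2 → ((gaugeAct u U y τ : (Matrix n n ℂ)ˣ) : Matrix n n ℂ) = exp (a y τ)) ∧
        (∀ (y : Site d) (τ : Fin d), l1 (y - x) ≤ 2 → ‖a y τ‖ ≤ α₀) ∧
        (∀ (y : Site d) (τ i : Fin d), l1 (y - x) ≤ 1 → ‖fd i (fun z => a z τ) y‖ ≤ α₁) ∧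
        (∀ (τ i l : Fin d), ‖fd i (fd l (fun z => a z τ)) x‖ ≤ α₂))
    (C : B11Thm1.Consts) (hB : C.B₃ ≤ 1 / 4)
    (hR : ∀ (k : ℕ) (ε₁ : ℝ), 0 < ε₁ → ε₁ ≤ C.a₁ → ∀ (V U : Site d → Fin d → (Matrix n n ℂ)ˣ), V ∈ sfClass d L N ε₁ 0 →
      IsMinimiser d (sfClass d L N (C.B₃ * ε₁)) L N (k + 1) V U →
        ∀ x : Site d, Regularity (torusVP d L N G (k + 1)) C.B₃ C.B₄ ε₁ U (x, L ^ (k + 1) - 1 + L ^ (k + 1) + 2))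
    (dom : Set (Site d → Fin d → (Matrix n n ℂ)ˣ)) :
    ∃ C' ε₀ : ℝ, 0 ≤ C' ∧ 0 < ε₀ ∧ ∀ ε : ℝ, 0 < ε → ε ≤ ε₀ → LeafH3sup d L N ε (C' * ε) (C' * ε) dom := by
  have hL1 : 1 ≤ L := by omega
  have hC0 := C0_pos d
  have hc2 := c2'_pos d L hL1
  refine ⟨16937, min (min (C.B₃ * C.a₁) (1 / 28)) (min (1 / (6 * C0 d)) (c2' d L / 4)), by norm_num,
    lt_min (lt_min (mul_pos C.B₃_pos C.a₁_pos) (by norm_num)) (lt_min (by positivity) (by positivity)), fun ε hε hεle => ?_⟩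
  have h1 : ε ≤ C.B₃ * C.a₁ := hεle.trans ((min_le_left _ _).trans (min_le_left _ _))
  have h2 : ε ≤ 1 / 28 := hεle.trans ((min_le_left _ _).trans (min_le_right _ _))
  have h3 : ε ≤ 1 / (6 * C0 d) := hεle.trans ((min_le_right _ _).trans (min_le_left _ _))
  have h4 : ε ≤ c2' d L / 4 := hεle.trans ((min_le_right _ _).trans (min_le_right _ _))
  have hε3 : C0 d * (2 * ε) ≤ 1 / 3 := by
    have h : ε * (6 * C0 d) ≤ 1 := by rwa [le_div_iff₀ (by positivity)] at h3
    nlinarith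
  have hε2 : 2 * (2 * ε) ≤ c2' d L := by linarith
  have h := leafH3sup_all_of_reg910Slot_of_B₃_le_quarter hL hGm hG C hB hR hε h1 h2 hε3 hε2 dom
  exact leafH3sup_mono h (by nlinarith) le_rfl

end GenericTwo

section RecordTwo

variable {N : ℕ} [NeZero N]

/-- **★ AT THE RECORD: A SLOT KEY WITH `B₃ ≤ 1∕4` WOULD CLOSE dag-n16-e's ORIGINAL `stub_h7 F` VERBATIM** (`d = 4`, `L = F.L`, `Nper = ne3NperOfRecord₁₁ F 0 0`, the NE3 domain
of record, any radii-monotone shape `G` with the (9)_{β₀=1} interface): the conclusion below is the TEXT of `stub_h7 F` of evidence #6 `N16DischargeTest.lean` — the leaf on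
ALL data of the domain, whose tight-window half this lineage located as model-false (file 5, FRONTS).  Both `hR` and the bound `C.B₃ ≤ 1∕4` are displayed hypotheses; the
statement records what a below-threshold producer would be claiming. [cite: Balaban1985Variational, Thm 1 (9)–(10) p.279] -/
theorem h7_at_record_of_reg910Slot_of_B₃_le_quarter (F : T4Family)
    {G : (Site 4 → Fin 4 → (MatA N)ˣ) → Site 4 → ℕ → ℝ → ℝ → ℝ → Prop} (hGm : RadiiMono 4 G)
    (hG : ∀ (U : Site 4 → Fin 4 → (MatA N)ˣ) (x : Site 4) (K : ℕ) (α₀ α₁ α₂ : ℝ), 2 ≤ K → G U x K α₀ α₁ α₂ →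
      ∃ (u : Site 4 → (MatA N)ˣ) (a : Site 4 → Fin 4 → MatA N),
        (∀ z, u z ∈ unitaryUnits (MatA N)) ∧
        (∀ (y : Site 4) (τ : Fin 4), l1 (y - x) ≤ 2 → ((gaugeAct u U y τ : (MatA N)ˣ) : MatA N) = exp (a y τ)) ∧
        (∀ (y : Site 4) (τ : Fin 4), l1 (y - x) ≤ 2 → ‖a y τ‖ ≤ α₀) ∧
        (∀ (y : Site 4) (τ i : Fin 4), l1 (y - x) ≤ 1 → ‖fd i (fun z => a z τ) y‖ ≤ α₁) ∧
        (∀ (τ i l : Fin 4), ‖fd i (fd l (fun z => a z τ)) x‖ ≤ α₂))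
    (C : B11Thm1.Consts) (hB : C.B₃ ≤ 1 / 4)
    (hR : ∀ (k : ℕ) (ε₁ : ℝ), 0 < ε₁ → ε₁ ≤ C.a₁ → ∀ (V U : Site 4 → Fin 4 → (MatA N)ˣ), V ∈ sfClass 4 F.L (ne3NperOfRecord₁₁ F 0 0) ε₁ 0 →
      IsMinimiser 4 (sfClass 4 F.L (ne3NperOfRecord₁₁ F 0 0) (C.B₃ * ε₁)) F.L (ne3NperOfRecord₁₁ F 0 0) (k + 1) V U →
        ∀ x : Site 4, Regularity (torusVP 4 F.L (ne3NperOfRecord₁₁ F 0 0) G (k + 1)) C.B₃ C.B₄ ε₁ U (x, F.L ^ (k + 1) - 1 + F.L ^ (k + 1) + 2)) :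
    ∃ C' ε₀ : ℝ, 0 ≤ C' ∧ 0 < ε₀ ∧ ∀ ε : ℝ, 0 < ε → ε ≤ ε₀ →
      LeafH3sup 4 F.L (ne3NperOfRecord₁₁ F 0 0) ε (C' * ε) (C' * ε) (ne3DomOfRecord₁₁ F N 0 0) :=
  h7Shape_of_reg910Slot_of_B₃_le_quarter F.hL.2 hGm hG C hB hR (ne3DomOfRecord₁₁ F N 0 0)

end RecordTwo

section GenericThree

variable {d : ℕ} {n : Type} [Fintype n] [DecidableEq n]

/-! ## §3 Window normalisation: the key is antitone in `1∕B₃` at fixed `B₃a₁`; `∃ C` ranges without loss over `B₃ ≥ 1∕4` -/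

/-- **`Regularity` OF THE TORUS INSTANCE READS `(B₃, ε)` ONLY THROUGH `B₃·ε` AND `B₄` ONLY THROUGH `0 < B₄`.**  For leaf-06's `torusVP` all three printed norms are the one
infimum `Ψ` and the Hölder slot is `0`; so r2's `B11.Regularity (torusVP d L N G k) B₃ B₄ ε U c` transfers to any `(B₃′, B₄′, ε′)` with `B₃′ε′ = B₃ε`, `0 < B₄′`, `0 < ε′`
(`L ≥ 1`). [folklore] -/
theorem regularity_torusVP_rescale {L N k : ℕ} (hL : 1 ≤ L) {G : (Site d → Fin d → (Matrix n n ℂ)ˣ) → Site d → ℕ → ℝ → ℝ → ℝ → Prop}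
    {B₃ B₄ ε B₃' B₄' ε' : ℝ} {U : Site d → Fin d → (Matrix n n ℂ)ˣ} {c : Site d × ℕ}
    (hreg : Regularity (torusVP d L N G k) B₃ B₄ ε U c) (hprod : B₃ * ε = B₃' * ε') (hB₄' : 0 < B₄') (hε' : 0 < ε') :
    Regularity (torusVP d L N G k) B₃' B₄' ε' U c := by
  obtain ⟨hne, h9, h9', -, h10⟩ := hreg
  have hL0 : (L : ℝ) ^ k ≠ 0 := pow_ne_zero _ (by exact_mod_cast (by omega : L ≠ 0))
  have hfac : (L : ℝ) ^ k * ((L : ℝ) ^ k)⁻¹ = 1 := mul_inv_cancel₀ hL0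
  have key : ∀ S T : ℝ, B₃ * S * ε * T = B₃' * S * ε' * T := by
    intro S T
    calc B₃ * S * ε * T = (B₃ * ε) * (S * T) := by ring
      _ = (B₃' * ε') * (S * T) := by rw [hprod]
      _ = B₃' * S * ε' * T := by ring
  refine ⟨hne, lt_of_lt_of_eq h9 (key _ _), lt_of_lt_of_eq h9' (key _ _), fun β _ _ => ?_, lt_of_lt_of_eq h10 (key _ _)⟩
  have hX : (0 : ℝ) < (((L : ℝ) ^ k * ((L : ℝ) ^ k)⁻¹)⁻¹) ^ (2 + β) :=
    Real.rpow_pos_of_pos (by rw [hfac, inv_one]; exact one_pos) _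
  show (0 : ℝ) < B₄' * cubeM L k c.2 * ε' * (((L : ℝ) ^ k * ((L : ℝ) ^ k)⁻¹)⁻¹) ^ (2 + β)
  exact mul_pos (mul_pos (mul_pos hB₄' (cubeM_pos hL k c.2)) hε') hX

/-- The rescaled datum radius `ε := C′.B₃ε₁∕C.B₃` of the window normalisation: `0 < ε`, `C.B₃ε = C′.B₃ε₁` (same (8)-class), `ε ≤ C.a₁` when `C′.B₃a₁′ ≤ C.B₃a₁`, and
`ε₁ ≤ ε` when `C.B₃ ≤ C′.B₃` (the (7)-window only shrinks). [folklore] -/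
theorem rescale_radius (C C' : B11Thm1.Consts) (hB : C.B₃ ≤ C'.B₃) (hA : C'.B₃ * C'.a₁ ≤ C.B₃ * C.a₁) {ε₁ : ℝ} (hε₁ : 0 < ε₁) (hε₁a : ε₁ ≤ C'.a₁) :
    0 < C'.B₃ * ε₁ / C.B₃ ∧ C.B₃ * (C'.B₃ * ε₁ / C.B₃) = C'.B₃ * ε₁ ∧ C'.B₃ * ε₁ / C.B₃ ≤ C.a₁ ∧ ε₁ ≤ C'.B₃ * ε₁ / C.B₃ := by
  have hB₃ := C.B₃_pos; have hB₃' := C'.B₃_pos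
  refine ⟨by positivity, by field_simp, ?_, ?_⟩
  · rw [div_le_iff₀ hB₃]
    nlinarith [mul_le_mul_of_nonneg_left hε₁a hB₃'.le]
  · rw [le_div_iff₀ hB₃]
    nlinarith [mul_le_mul_of_nonneg_right hB hε₁.le]

/-- **★ THE SLOT KEY (T9ˢ) IS ANTITONE IN THE WINDOW RATIO `1∕B₃` AT FIXED TOP RADIUS.**  If (T9ˢ) holds at `(G, C)` then it holds at `(G, C′)` for every block of constants
with `C.B₃ ≤ C′.B₃` and `C′.B₃·C′.a₁ ≤ C.B₃·C.a₁` (`L ≥ 1`): read the key at `C` with the rescaled datum radius of `rescale_radius` (same (8)-class, smaller (7)-window), then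
`regularity_torusVP_rescale`.  So enlarging `B₃` only WEAKENS the key. [cite: Balaban1985Variational, Thm 1 (9)–(10) p.279] -/
theorem reg910Slot_mono_B₃ {L N : ℕ} (hL : 1 ≤ L) {G : (Site d → Fin d → (Matrix n n ℂ)ˣ) → Site d → ℕ → ℝ → ℝ → ℝ → Prop}
    (C C' : B11Thm1.Consts) (hB : C.B₃ ≤ C'.B₃) (hA : C'.B₃ * C'.a₁ ≤ C.B₃ * C.a₁)
    (hR : ∀ (k : ℕ) (ε₁ : ℝ), 0 < ε₁ → ε₁ ≤ C.a₁ → ∀ (V U : Site d → Fin d → (Matrix n n ℂ)ˣ), V ∈ sfClass d L N ε₁ 0 →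
      IsMinimiser d (sfClass d L N (C.B₃ * ε₁)) L N (k + 1) V U →
        ∀ x : Site d, Regularity (torusVP d L N G (k + 1)) C.B₃ C.B₄ ε₁ U (x, L ^ (k + 1) - 1 + L ^ (k + 1) + 2)) :
    ∀ (k : ℕ) (ε₁ : ℝ), 0 < ε₁ → ε₁ ≤ C'.a₁ → ∀ (V U : Site d → Fin d → (Matrix n n ℂ)ˣ), V ∈ sfClass d L N ε₁ 0 →
      IsMinimiser d (sfClass d L N (C'.B₃ * ε₁)) L N (k + 1) V U →
        ∀ x : Site d, Regularity (torusVP d L N G (k + 1)) C'.B₃ C'.B₄ ε₁ U (x, L ^ (k + 1) - 1 + L ^ (k + 1) + 2) := by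
  intro k ε₁ hε₁ hε₁a V U hV hU x
  obtain ⟨hε, hprod, hεa, hε₁ε⟩ := rescale_radius C C' hB hA hε₁ hε₁a
  have hU' : IsMinimiser d (sfClass d L N (C.B₃ * (C'.B₃ * ε₁ / C.B₃))) L N (k + 1) V U := by rw [hprod]; exact hU
  exact regularity_torusVP_rescale hL (hR k _ hε hεa V U (sfClass_mono hε₁ε hV) hU' x) hprod C'.B₄_pos hε₁

/-- **THE EXISTENCE HALF (T8) IS ANTITONE IN THE WINDOW RATIO TOO** (same rescaling; no instance field is read): (T8) at `C` implies (T8) at every `C′` with `C.B₃ ≤ C′.B₃`,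
`C′.B₃·C′.a₁ ≤ C.B₃·C.a₁`. [cite: Balaban1985Variational, Thm 1 (8) p.279] -/
theorem exists8Min_mono_B₃ {L N : ℕ} (C C' : B11Thm1.Consts) (hB : C.B₃ ≤ C'.B₃) (hA : C'.B₃ * C'.a₁ ≤ C.B₃ * C.a₁)
    (hE : ∀ (k : ℕ) (ε₁ : ℝ), 0 < ε₁ → ε₁ ≤ C.a₁ → ∀ V : Site d → Fin d → (Matrix n n ℂ)ˣ, V ∈ sfClass d L N ε₁ 0 →
      ∃ U : Site d → Fin d → (Matrix n n ℂ)ˣ, IsMinimiser d (sfClass d L N (C.B₃ * ε₁)) L N (k + 1) V U) :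
    ∀ (k : ℕ) (ε₁ : ℝ), 0 < ε₁ → ε₁ ≤ C'.a₁ → ∀ V : Site d → Fin d → (Matrix n n ℂ)ˣ, V ∈ sfClass d L N ε₁ 0 →
      ∃ U : Site d → Fin d → (Matrix n n ℂ)ˣ, IsMinimiser d (sfClass d L N (C'.B₃ * ε₁)) L N (k + 1) V U := by
  intro k ε₁ hε₁ hε₁a V hV
  obtain ⟨hε, hprod, hεa, hε₁ε⟩ := rescale_radius C C' hB hA hε₁ hε₁a
  obtain ⟨U, hU⟩ := hE k _ hε hεa V (sfClass_mono hε₁ε hV)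
  exact ⟨U, by rw [← hprod]; exact hU⟩

/-- **★ `∃ C` RANGES WITHOUT LOSS OVER `B₃ ≥ 1∕4`** (the slot key (T9ˢ) at a fixed shape `G`; `L ≥ 1`): if the key holds at some `C` with `C.B₃ < 1∕4`, it holds at the
block `C′ = (a₀, 4B₃a₁, 1∕4, B₄, M(·))` (same top radius `B₃a₁ ≤ a₀`) by `reg910Slot_mono_B₃`.  So the producer may as well take `B₃ ≥ 1∕4` (print does: `B₃ ≥ 72d³L³B₀`),
and a disprover need only defeat `B₃ ≥ 1∕4` — below it §2 says the key is the full-window leaf anyway. [folklore] -/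
theorem exists_consts_iff_quarter_le {L N : ℕ} (hL : 1 ≤ L) {G : (Site d → Fin d → (Matrix n n ℂ)ˣ) → Site d → ℕ → ℝ → ℝ → ℝ → Prop} :
    (∃ C : B11Thm1.Consts, ∀ (k : ℕ) (ε₁ : ℝ), 0 < ε₁ → ε₁ ≤ C.a₁ → ∀ (V U : Site d → Fin d → (Matrix n n ℂ)ˣ), V ∈ sfClass d L N ε₁ 0 →
      IsMinimiser d (sfClass d L N (C.B₃ * ε₁)) L N (k + 1) V U →
        ∀ x : Site d, Regularity (torusVP d L N G (k + 1)) C.B₃ C.B₄ ε₁ U (x, L ^ (k + 1) - 1 + L ^ (k + 1) + 2)) ↔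
    (∃ C : B11Thm1.Consts, 1 / 4 ≤ C.B₃ ∧ ∀ (k : ℕ) (ε₁ : ℝ), 0 < ε₁ → ε₁ ≤ C.a₁ → ∀ (V U : Site d → Fin d → (Matrix n n ℂ)ˣ), V ∈ sfClass d L N ε₁ 0 →
      IsMinimiser d (sfClass d L N (C.B₃ * ε₁)) L N (k + 1) V U →
        ∀ x : Site d, Regularity (torusVP d L N G (k + 1)) C.B₃ C.B₄ ε₁ U (x, L ^ (k + 1) - 1 + L ^ (k + 1) + 2)) := by
  refine ⟨?_, fun ⟨C, _, hR⟩ => ⟨C, hR⟩⟩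
  rintro ⟨C, hR⟩
  by_cases h : 1 / 4 ≤ C.B₃
  · exact ⟨C, h, hR⟩
  · have hlt : C.B₃ < 1 / 4 := lt_of_not_ge h
    have hB₃ := C.B₃_pos
    have ha₁ := C.a₁_pos
    let C' : B11Thm1.Consts :=
      { a₀ := C.a₀, a₁ := 4 * C.B₃ * C.a₁, B₃ := 1 / 4, B₄ := C.B₄, Mfun := C.Mfun,
        a₀_pos := C.a₀_pos, a₁_pos := by positivity, B₃_pos := by norm_num, B₄_pos := C.B₄_pos,
        B₃a₁_le := by nlinarith [C.B₃a₁_le], Mfun_pos := C.Mfun_pos }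
    refine ⟨C', le_rfl, reg910Slot_mono_B₃ hL C C' hlt.le ?_ hR⟩
    show 1 / 4 * (4 * C.B₃ * C.a₁) ≤ C.B₃ * C.a₁
    linarith

/-- **THE DISCHARGE-TESTS' STUB SHAPE, NORMALISED** (`∃ G C, RadiiMono d G ∧ interface G ∧ (T9ˢ)(G, C)` = the text of dag-n16-e's v6 ∕ dag-n16-w2's v6L `stub_reg910Slot`,
read generically in `(d, n, L, N)`; `L ≥ 1`): any inhabitant yields one with `1∕4 ≤ C.B₃` (the converse drops the bound).  Nothing of it is asserted here. [folklore] -/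
theorem exists_shape_quarter_le_of_exists_shape {L N : ℕ} (hL : 1 ≤ L)
    {IF : ((Site d → Fin d → (Matrix n n ℂ)ˣ) → Site d → ℕ → ℝ → ℝ → ℝ → Prop) → Prop}
    (h : ∃ (G : (Site d → Fin d → (Matrix n n ℂ)ˣ) → Site d → ℕ → ℝ → ℝ → ℝ → Prop) (C : B11Thm1.Consts), RadiiMono d G ∧ IF G ∧
      (∀ (k : ℕ) (ε₁ : ℝ), 0 < ε₁ → ε₁ ≤ C.a₁ → ∀ (V U : Site d → Fin d → (Matrix n n ℂ)ˣ), V ∈ sfClass d L N ε₁ 0 →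
        IsMinimiser d (sfClass d L N (C.B₃ * ε₁)) L N (k + 1) V U →
          ∀ x : Site d, Regularity (torusVP d L N G (k + 1)) C.B₃ C.B₄ ε₁ U (x, L ^ (k + 1) - 1 + L ^ (k + 1) + 2))) :
    ∃ (G : (Site d → Fin d → (Matrix n n ℂ)ˣ) → Site d → ℕ → ℝ → ℝ → ℝ → Prop) (C : B11Thm1.Consts), RadiiMono d G ∧ IF G ∧ 1 / 4 ≤ C.B₃ ∧
      (∀ (k : ℕ) (ε₁ : ℝ), 0 < ε₁ → ε₁ ≤ C.a₁ → ∀ (V U : Site d → Fin d → (Matrix n n ℂ)ˣ), V ∈ sfClass d L N ε₁ 0 →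
        IsMinimiser d (sfClass d L N (C.B₃ * ε₁)) L N (k + 1) V U →
          ∀ x : Site d, Regularity (torusVP d L N G (k + 1)) C.B₃ C.B₄ ε₁ U (x, L ^ (k + 1) - 1 + L ^ (k + 1) + 2)) := by
  obtain ⟨G, C, hGm, hG, hR⟩ := h
  obtain ⟨C', hq, hR'⟩ := (exists_consts_iff_quarter_le (G := G) hL).1 ⟨C, hR⟩
  exact ⟨G, C', hGm, hG, hq, hR'⟩

end GenericThree

end

end Summit.QuantumFields.YangMills.BalabanUVNodes.N16SlotKeyQuarter
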